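import Summits.RiemannHypothesis.RiemannHypothesis.Theorems.SemilocalDeletionToeplitzFloor
import HarnessLib

/-!
# The Toeplitz floor with ONE, TWO and THREE visible powers: closed forms, and the `(2/3)·log 3` law at `p = 3`

Certificates for the fibre form of `SemilocalDeletionToeplitzFloor.re_weilSemilocalQuadratic_erase_ge_of_cert`
(`A_m(p) + μI ⪰ 0`, `A_m(p) = [log p · p^{−|i−j|/2}]_{i≠j}`), written as explicit sums of squares so that no eigenvalue theory is needed:

* `m = 1` (`2c < 2·log p`): `μ = w₁ = log p/√p`, `A₁ + w₁I = w₁(1,1)(1,1)ᵀ` — the cliff of `SemilocalDeletionCliff.lean` again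
  (`re_weilSemilocalQuadratic_erase_ge_cert_one`);
* `m = 2` (`2c < 3·log p`, atoms `p` and `p²`, `w₂ = log p/p`): **`μ₂(p) = (√(w₂² + 8w₁²) − w₂)/2 = (log p/(2p))·(√(1+8p) − 1)`**, the
  positive root of `μ² + w₂μ − 2w₁² = 0`, i.e. `−μ₂(p)` = the bottom eigenvalue of `[[0,w₁,w₂],[w₁,0,w₁],[w₂,w₁,0]]` (eigenvector
  `(1, −2w₁/(μ₂+w₂), 1)`: an alternating 3-block comb); certificate
  `(μ+w₂)·form = 2|(μ+w₂)(z₀+z₂)/2 + w₁z₁|² + (μ+w₂)(μ−w₂)|z₀−z₂|²/2` (`sos_two`);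
  `re_weilSemilocalQuadratic_erase_ge_two`, `semilocalGroundEnergy_erase_ge_two`:
  **`λ_min(S∖p; c; P) ≥ λ_min(S; c; P) − μ₂(p)` for every finite `S ∋ p`, every `P`, every `c < (3/2)·log p`**;
* `p = 3`: `√25 = 5` makes `μ₂(3) = 2·log 3/3 = 0.732408…` (`re_weilSemilocalQuadratic_erase_three_ge`,
  `semilocalGroundEnergy_erase_three_ge`): deleting `3` costs at most `(2/3)·log 3` on every window `c < 1.648`;
* `mu_two_bounds`: `w₁ < μ₂(p) < √2·w₁` — the second atom ALWAYS deepens the cliff, by a factor `< √2` (`1.104` at `p = 2`,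
  `2/√3` at `p = 3`, `→ √2` as `p → ∞`);
* `m = 3` (`2c < 4·log p`; §8): by the reversal symmetry of `A₃(p)` the bottom sits in the antisymmetric sector,
  **`μ₃(p) = ((a + c₃) + √((a − c₃)² + 4(a − b)²))/2`**, `a = w₁`, `b = w₂`, `c₃ = log p/(p√p)` (`μ₃(2) = 0.556336` vs lineage E
  `U(1.35)∖{2}` free-odd `−0.556173`; `μ₃(3) = 0.764278`): `cert_three`, `re_weilSemilocalQuadratic_erase_ge_three`,
  `semilocalGroundEnergy_erase_ge_three` — so every single deletion of `3` on a window `c < 2·log 3 = 2.197` and of `2` on `c < 2·log 2`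
  now has its sharp floor as a theorem.

DATA (lineage E, EXTREMALS/semilocal/Shier-E-v8, `U(b)∖{p}`, N = 200 unless stated; `Δ` = certified bottom minus `−μ₂(p)`):
`p = 2` (`b ∈ (0.69, 1.04)`, `−μ₂ = −0.541193`): `Δ = 2.4e−2, 1.1e−2, 2.3e−3, 6.9e−4` at `b = 0.85, 0.90, 0.95, 1.00` (even sector);
`p = 3` (`b ∈ (1.10, 1.65)`, `−μ₂ = −0.732408`): `Δ = 9.8e−2, 2.3e−2, 4.2e−3, 7.0e−4, 1.2e−4, 1.6e−6` at `b = 1.10, 1.25, 1.35, 1.40, 1.45, 1.55`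
(even); `p = 5` (`b = 1.7`, room `0.09`): `Δ = 5.5e−2`.  `Δ ≥ 0` in every cell, as the theorem demands; `Δ → 0` is the law's other
half (a comb upper bound, modulo window energies, in the manner of `SemilocalDeletionPairCeiling`).  Nothing here bears on RH.
-/

set_option linter.dupNamespace false

noncomputable section

open Complex Filter Set MeasureTheory
open scoped Real Topology ComplexConjugate

namespace Summit.RiemannHypothesis.RiemannHypothesis.Theorems.SemilocalDeletionToeplitzFloorTwo

open Literature.NumberTheory.LFunctions
open Summit.RiemannHypothesis.RiemannHypothesis.Theorems.HandoffSemilocalEnergy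
open Summit.RiemannHypothesis.RiemannHypothesis.Theorems.SemilocalDeletionToeplitzFloor

variable {g : ℝ → ℂ} {P : (ℝ → ℂ) → Prop}

/-! ## §6  Certificates: one atom (the cliff again) and TWO atoms in closed form -/

/-- Sum of squares behind the one-atom certificate: `w(|z₀|² + |z₁|²) + 2w·Re(z₀ z̄₁) = w|z₀ + z₁|² ≥ 0`. -/
theorem sos_one {w : ℝ} (hw : 0 ≤ w) (x₀ y₀ x₁ y₁ : ℝ) :
    0 ≤ w * (x₀ ^ 2 + y₀ ^ 2 + (x₁ ^ 2 + y₁ ^ 2)) + 2 * w * (x₀ * x₁ + y₀ * y₁) := by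
  have : w * (x₀ ^ 2 + y₀ ^ 2 + (x₁ ^ 2 + y₁ ^ 2)) + 2 * w * (x₀ * x₁ + y₀ * y₁) =
      w * ((x₀ + x₁) ^ 2 + (y₀ + y₁) ^ 2) := by ring
  rw [this]; positivity

/-- Sum of squares behind the TWO-atom certificate.  With `μ(μ + w₂) = 2w₁²`, `0 ≤ w₂ ≤ μ`, `0 < μ`:
`μΣ|z_i|² + 2w₁Re(z₀z̄₁ + z₁z̄₂) + 2w₂Re(z₀z̄₂) ≥ 0` — indeed `(μ + w₂)·(form) = 2|(μ+w₂)(z₀+z₂)/2 + w₁z₁|² + (μ+w₂)(μ−w₂)|z₀−z₂|²/2`.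
This is `A₂(p) + μI ⪰ 0` for the zero-diagonal Toeplitz matrix `A₂ = [[0,w₁,w₂],[w₁,0,w₁],[w₂,w₁,0]]`, singular exactly at the root. -/
theorem sos_two {μ w₁ w₂ : ℝ} (hμ : 0 < μ) (hw₂ : 0 ≤ w₂) (hle : w₂ ≤ μ) (hroot : μ * (μ + w₂) = 2 * w₁ ^ 2)
    (x₀ y₀ x₁ y₁ x₂ y₂ : ℝ) :
    0 ≤ μ * (x₀ ^ 2 + y₀ ^ 2 + (x₁ ^ 2 + y₁ ^ 2) + (x₂ ^ 2 + y₂ ^ 2)) +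
      2 * w₁ * (x₀ * x₁ + y₀ * y₁ + (x₁ * x₂ + y₁ * y₂)) + 2 * w₂ * (x₀ * x₂ + y₀ * y₂) := by
  set F := μ * (x₀ ^ 2 + y₀ ^ 2 + (x₁ ^ 2 + y₁ ^ 2) + (x₂ ^ 2 + y₂ ^ 2)) +
      2 * w₁ * (x₀ * x₁ + y₀ * y₁ + (x₁ * x₂ + y₁ * y₂)) + 2 * w₂ * (x₀ * x₂ + y₀ * y₂) with hF
  have key : (μ + w₂) * F = 2 * ((μ + w₂) * (x₀ + x₂) / 2 + w₁ * x₁) ^ 2 + 2 * ((μ + w₂) * (y₀ + y₂) / 2 + w₁ * y₁) ^ 2 +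
      (μ + w₂) * (μ - w₂) * ((x₀ - x₂) ^ 2 + (y₀ - y₂) ^ 2) / 2 := by
    rw [hF]; linear_combination (x₁ ^ 2 + y₁ ^ 2) * hroot
  have hpos : 0 < μ + w₂ := by linarith
  have hS : 0 ≤ (μ + w₂) * F := by
    rw [key]
    have : 0 ≤ (μ + w₂) * (μ - w₂) * ((x₀ - x₂) ^ 2 + (y₀ - y₂) ^ 2) / 2 :=
      div_nonneg (mul_nonneg (mul_nonneg hpos.le (by linarith)) (by positivity)) (by norm_num)
    positivity
  by_contra h
  push Not at h
  linarith [mul_neg_of_pos_of_neg hpos h]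

/-- **ONE ATOM (the cliff, from the certificate).**  For `p ∈ S` prime and `tsupport g ⊆ [−c, c]` with `2c < 2·log p`
(only `p` visible): `Re Q_{S∖{p}}(g) ≥ Re Q_S(g) − (log p/√p)‖g‖₂²` — `SemilocalDeletionCliff`'s floor, recovered as the
`1×1`-fibre case `μ = w₁` of the Toeplitz certificate (`A₁ + w₁I = w₁·(1,1)(1,1)ᵀ ⪰ 0`). -/
theorem re_weilSemilocalQuadratic_erase_ge_cert_one (hg : IsWeilTest g) {S : Finset ℕ} {p : ℕ} (hp : p.Prime)
    (hpS : p ∈ S) {c : ℝ} (hsupp : tsupport g ⊆ Icc (-c) c) (hc : 2 * c < 2 * Real.log p) :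
    (weilSemilocalQuadratic S g).re - Real.log p / Real.sqrt p * ∫ u : ℝ, ‖g u‖ ^ 2 ≤
      (weilSemilocalQuadratic (S.erase p) g).re := by
  have hm : 2 * c < ((1 : ℕ) + 1) * Real.log p := by push_cast; linarith
  have hw : 0 ≤ Real.log p / Real.sqrt p :=
    div_nonneg (Real.log_nonneg (by exact_mod_cast hp.one_lt.le)) (Real.sqrt_nonneg _)
  refine re_weilSemilocalQuadratic_erase_ge_of_cert hg hp hpS hsupp hm fun G hG1 hG2 ↦ ?_
  have h1 : G (-1) = 0 := hG1 (-1) (by norm_num)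
  have h2 : G 2 = 0 := hG2 2 (by norm_num)
  simp only [Finset.sum_range_succ, Finset.sum_range_zero, zero_add, Nat.cast_one, CharP.cast_eq_zero, pow_one]
  simp only [show (0 : ℤ) - 1 = -1 by norm_num, show (1 : ℤ) - 1 = 0 by norm_num, show (1 : ℤ) + 1 = 2 by norm_num,
    h1, h2, map_zero, mul_zero, zero_add, add_zero]
  have norm_sq_eq_re_im : ∀ z : ℂ, ‖z‖ ^ 2 = z.re ^ 2 + z.im ^ 2 := fun z ↦ by rw [Complex.sq_norm, Complex.normSq_apply]; ring
  have re_mul_conj_eq : ∀ z w : ℂ, (z * conj w).re = z.re * w.re + z.im * w.im := fun z w ↦ by simp [Complex.mul_re]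
  simp only [norm_sq_eq_re_im, re_mul_conj_eq]
  linarith [sos_one hw (G 0).re (G 0).im (G 1).re (G 1).im]

/-- **TWO ATOMS, CLOSED FORM.**  For `p ∈ S` prime and `tsupport g ⊆ [−c, c]` with `2c < 3·log p` (at most `p` and `p²`
visible): `Re Q_{S∖{p}}(g) ≥ Re Q_S(g) − μ₂(p)‖g‖₂²` with

  `μ₂(p) = (log p/(2p))·(√(1 + 8p) − 1) = (√(w₂² + 8w₁²) − w₂)/2`, `w₁ = log p/√p`, `w₂ = log p/p`,

`−μ₂(p)` = the BOTTOM EIGENVALUE of `A₂(p) = [[0,w₁,w₂],[w₁,0,w₁],[w₂,w₁,0]]` (root of `μ² + w₂μ − 2w₁² = 0`).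
Lineage-E data (Shier-E-v8, `U(b)∖{p}`, N = 200): `p = 2`: `−0.540501` at `b = 1.0` vs `−μ₂(2) = −0.541193`;
`p = 3`: `−0.732407` at `b = 1.55` vs `−μ₂(3) = −2·log 3/3 = −0.732408`; `p = 5`: `−0.8146` at `b = 1.7` (room `0.09`) vs `−0.869599`. -/
theorem re_weilSemilocalQuadratic_erase_ge_two (hg : IsWeilTest g) {S : Finset ℕ} {p : ℕ} (hp : p.Prime) (hpS : p ∈ S)
    {c : ℝ} (hsupp : tsupport g ⊆ Icc (-c) c) (hc : 2 * c < 3 * Real.log p) :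
    (weilSemilocalQuadratic S g).re - Real.log p / (2 * p) * (Real.sqrt (1 + 8 * p) - 1) * ∫ u : ℝ, ‖g u‖ ^ 2 ≤
      (weilSemilocalQuadratic (S.erase p) g).re := by
  have hm : 2 * c < ((2 : ℕ) + 1) * Real.log p := by push_cast; linarith
  have hp0 : (0 : ℝ) < p := by exact_mod_cast hp.pos
  have hp1 : (1 : ℝ) ≤ p := by exact_mod_cast hp.one_lt.le
  have hL : 0 < Real.log p := Real.log_pos (by exact_mod_cast hp.one_lt)
  set s := Real.sqrt (1 + 8 * p) with hsdef
  have hs2 : s ^ 2 = 1 + 8 * p := Real.sq_sqrt (by positivity)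
  have hs3 : 3 ≤ s := by
    rw [hsdef, show (3 : ℝ) = Real.sqrt (3 ^ 2) by rw [Real.sqrt_sq (by norm_num)]]
    exact Real.sqrt_le_sqrt (by nlinarith)
  have hsq : Real.sqrt ((p : ℝ) ^ 2) = p := Real.sqrt_sq hp0.le
  have hsp : Real.sqrt p ^ 2 = p := Real.sq_sqrt hp0.le
  have hsp0 : 0 < Real.sqrt p := Real.sqrt_pos.2 hp0
  -- the three certificate conditions for μ = μ₂(p), w₁ = L/√p, w₂ = L/p
  set μ := Real.log p / (2 * p) * (s - 1) with hμdef
  have hμ : 0 < μ := by rw [hμdef]; exact mul_pos (div_pos hL (by positivity)) (by linarith)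
  have hw₂ : 0 ≤ Real.log p / p := div_nonneg hL.le hp0.le
  have hle : Real.log p / p ≤ μ := by
    rw [hμdef, div_mul_eq_mul_div, div_le_div_iff₀ hp0 (by positivity)]
    nlinarith [mul_nonneg (mul_pos hL hp0).le (sub_nonneg.2 hs3)]
  have hroot : μ * (μ + Real.log p / p) = 2 * (Real.log p / Real.sqrt p) ^ 2 := by
    calc μ * (μ + Real.log p / p) = Real.log p ^ 2 * (s ^ 2 - 1) / (4 * p ^ 2) := by rw [hμdef]; field_simp; ring
      _ = 2 * (Real.log p / Real.sqrt p) ^ 2 := by rw [hs2, div_pow, hsp]; field_simp; ring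
  refine re_weilSemilocalQuadratic_erase_ge_of_cert hg hp hpS hsupp hm fun G hG1 hG2 ↦ ?_
  have h1 : G (-1) = 0 := hG1 (-1) (by norm_num)
  have h2 : G (-2) = 0 := hG1 (-2) (by norm_num)
  have h3 : G 3 = 0 := hG2 3 (by norm_num)
  have h4 : G 4 = 0 := hG2 4 (by norm_num)
  simp only [Finset.sum_range_succ, Finset.sum_range_zero, zero_add, Nat.cast_one, Nat.cast_ofNat, CharP.cast_eq_zero,
    pow_one]
  simp only [show (1 : ℤ) + 1 = 2 by norm_num, show (1 : ℕ) + 1 = 2 by norm_num, show (0 : ℤ) - 1 = -1 by norm_num,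
    show (0 : ℤ) - 2 = -2 by norm_num, show (1 : ℤ) - 1 = 0 by norm_num, show (1 : ℤ) - 2 = -1 by norm_num,
    show (1 : ℤ) + 2 = 3 by norm_num, show (2 : ℤ) - 1 = 1 by norm_num, show (2 : ℤ) + 1 = 3 by norm_num,
    show (2 : ℤ) - 2 = 0 by norm_num, show (2 : ℤ) + 2 = 4 by norm_num, h1, h2, h3, h4, hsq,
    map_zero, mul_zero, zero_add, add_zero]
  have norm_sq_eq_re_im : ∀ z : ℂ, ‖z‖ ^ 2 = z.re ^ 2 + z.im ^ 2 := fun z ↦ by rw [Complex.sq_norm, Complex.normSq_apply]; ring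
  have re_mul_conj_eq : ∀ z w : ℂ, (z * conj w).re = z.re * w.re + z.im * w.im := fun z w ↦ by simp [Complex.mul_re]
  simp only [norm_sq_eq_re_im, Complex.add_re, Complex.zero_re, add_zero, re_mul_conj_eq]
  linarith [sos_two hμ hw₂ hle hroot (G 0).re (G 0).im (G 1).re (G 1).im (G 2).re (G 2).im]

/-- **`p = 3`: deleting the prime 3 costs at most `(2/3)·log 3 = 0.7324…` on every window `c < (3/2)·log 3 = 1.648`** (atoms `3` and
`9`; `μ₂(3) = (log 3/6)(√25 − 1) = 2·log 3/3` exactly — lineage E: `U(1.55)∖{3}` even sector `−0.732407`, `1.6e−6` above). -/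
theorem re_weilSemilocalQuadratic_erase_three_ge (hg : IsWeilTest g) {S : Finset ℕ} (h3S : 3 ∈ S) {c : ℝ}
    (hsupp : tsupport g ⊆ Icc (-c) c) (hc : 2 * c < 3 * Real.log 3) :
    (weilSemilocalQuadratic S g).re - 2 * Real.log 3 / 3 * ∫ u : ℝ, ‖g u‖ ^ 2 ≤
      (weilSemilocalQuadratic (S.erase 3) g).re := by
  have h := re_weilSemilocalQuadratic_erase_ge_two hg Nat.prime_three h3S hsupp (by exact_mod_cast hc)
  have h25 : Real.sqrt (1 + 8 * ((3 : ℕ) : ℝ)) = 5 := by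
    rw [show (1 + 8 * ((3 : ℕ) : ℝ)) = 5 ^ 2 by norm_num]; exact Real.sqrt_sq (by norm_num)
  rw [h25] at h
  norm_num at h
  linarith

/-- **The second atom deepens the cliff by a factor strictly between `1` and `√2`:** `log p/√p < μ₂(p) < √2·log p/√p`
(`μ₂/w₁ = 1.104` at `p = 2`, `= 2/√3 = 1.1547` at `p = 3`, `→ √2` as `p → ∞`). -/
theorem mu_two_bounds {p : ℕ} (hp : p.Prime) :
    Real.log p / Real.sqrt p < Real.log p / (2 * p) * (Real.sqrt (1 + 8 * p) - 1) ∧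
      Real.log p / (2 * p) * (Real.sqrt (1 + 8 * p) - 1) < Real.sqrt 2 * (Real.log p / Real.sqrt p) := by
  have hp0 : (0 : ℝ) < p := by exact_mod_cast hp.pos
  have hp1 : (1 : ℝ) < p := by exact_mod_cast hp.one_lt
  have hL : 0 < Real.log p := Real.log_pos hp1
  have hr0 : 0 < Real.sqrt p := Real.sqrt_pos.2 hp0
  have hr : Real.sqrt p ^ 2 = p := Real.sq_sqrt hp0.le
  have hr1 : 1 < Real.sqrt p := by rw [show (1 : ℝ) = Real.sqrt 1 by simp]; exact Real.sqrt_lt_sqrt (by norm_num) hp1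
  have hs0 : 0 ≤ Real.sqrt (1 + 8 * p) := Real.sqrt_nonneg _
  have hs : Real.sqrt (1 + 8 * p) ^ 2 = 1 + 8 * p := Real.sq_sqrt (by positivity)
  have h20 : 0 < Real.sqrt 2 := by positivity
  have h2 : Real.sqrt 2 ^ 2 = 2 := Real.sq_sqrt (by norm_num)
  -- `1 + 2√p < √(1+8p) < 1 + 2√2·√p`
  have hlow : 1 + 2 * Real.sqrt p < Real.sqrt (1 + 8 * p) := by
    have : (1 + 2 * Real.sqrt p) ^ 2 < 1 + 8 * p := by nlinarith
    exact lt_of_pow_lt_pow_left₀ 2 hs0 (by rw [hs]; exact this)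
  have hupp : Real.sqrt (1 + 8 * p) < 1 + 2 * Real.sqrt 2 * Real.sqrt p := by
    have : 1 + 8 * (p : ℝ) < (1 + 2 * Real.sqrt 2 * Real.sqrt p) ^ 2 := by nlinarith [mul_pos h20 hr0]
    exact lt_of_pow_lt_pow_left₀ 2 (by positivity) (by rw [hs]; exact this)
  constructor
  · rw [div_mul_eq_mul_div, div_lt_div_iff₀ hr0 (by positivity)]
    nlinarith [mul_pos hL hr0]
  · rw [div_mul_eq_mul_div, div_lt_iff₀ (by positivity : (0 : ℝ) < 2 * p)]
    rw [show Real.sqrt 2 * (Real.log p / Real.sqrt p) * (2 * p) = Real.log p * (2 * Real.sqrt 2 * Real.sqrt p) by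
      field_simp; nlinarith [hr]]
    nlinarith [mul_pos hL hr0]

/-! ## §7  Energy language -/

/-- **Two-atom floor for the bottoms.** `λ_min(S∖{p}; c; P) ≥ λ_min(S; c; P) − μ₂(p)` whenever `2c < 3·log p`, every constraint `P`. -/
theorem semilocalGroundEnergy_erase_ge_two {S : Finset ℕ} {p : ℕ} (hp : p.Prime) (hpS : p ∈ S) {c : ℝ}
    (hc : 2 * c < 3 * Real.log p) :
    semilocalGroundEnergy S P c - Real.log p / (2 * p) * (Real.sqrt (1 + 8 * p) - 1) ≤
      semilocalGroundEnergy (S.erase p) P c := by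
  rcases (semilocalSphereValues (S.erase p) P c).eq_empty_or_nonempty with he | hne
  · have he' : semilocalSphereValues S P c = ∅ := by
      rcases (semilocalSphereValues S P c).eq_empty_or_nonempty with h0 | h0
      · exact h0
      · have := (semilocalSphereValues_nonempty_iff S P c).1 h0
        rw [← semilocalSphereValues_nonempty_iff (S.erase p) P c, he] at this
        exact absurd this Set.not_nonempty_empty
    rw [semilocalGroundEnergy, semilocalGroundEnergy, he, he', Real.sInf_empty]
    linarith [(mu_two_bounds hp).1, div_nonneg (Real.log_nonneg (by exact_mod_cast hp.one_lt.le : (1 : ℝ) ≤ p))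
      (Real.sqrt_nonneg (p : ℝ))]
  · refine le_semilocalGroundEnergy hne fun g hg hs hPg hn ↦ ?_
    have h1 := re_weilSemilocalQuadratic_erase_ge_two hg hp hpS hs hc
    have h2 := semilocalGroundEnergy_le_re (S := S) hg hs hPg hn
    rw [hn, mul_one] at h1
    linarith

/-- **`p = 3` for the bottoms:** `λ_min(S∖{3}; c; P) ≥ λ_min(S; c; P) − 2·log 3/3` whenever `3 ∈ S` and `c < (3/2)·log 3`. -/
theorem semilocalGroundEnergy_erase_three_ge {S : Finset ℕ} (h3S : 3 ∈ S) {c : ℝ} (hc : 2 * c < 3 * Real.log 3) :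
    semilocalGroundEnergy S P c - 2 * Real.log 3 / 3 ≤ semilocalGroundEnergy (S.erase 3) P c := by
  have h := semilocalGroundEnergy_erase_ge_two (P := P) Nat.prime_three h3S (by exact_mod_cast hc)
  have h25 : Real.sqrt (1 + 8 * ((3 : ℕ) : ℝ)) = 5 := by
    rw [show (1 + 8 * ((3 : ℕ) : ℝ)) = 5 ^ 2 by norm_num]; exact Real.sqrt_sq (by norm_num)
  rw [h25] at h
  norm_num at h
  linarith

/-! ## §8  THREE atoms (`2c < 4·log p`): closed form by the reversal symmetry of `A₃(p)` -/

/-- Sum of squares behind the THREE-atom certificate.  Write the `4×4` form in the symmetric/antisymmetric coordinates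
`s = (z₀+z₃, z₁+z₂)`, `t = (z₀−z₃, z₁−z₂)`: it splits into the `2×2` blocks `[[μ+c, a+b],[a+b, μ+a]]` (positive semidefinite: `hpd`) and
`[[μ−c, a−b],[a−b, μ−a]]` (singular at the root: `hroot`), so `μΣ|z_i|² + 2a·Re(z₀z̄₁+z₁z̄₂+z₂z̄₃) + 2b·Re(z₀z̄₂+z₁z̄₃) + 2c·Re(z₀z̄₃) ≥ 0`. -/
theorem sos_three {μ a b c : ℝ} (hc : 0 ≤ c) (hμc : c < μ) (hroot : (μ - a) * (μ - c) = (a - b) ^ 2)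
    (hpd : (a + b) ^ 2 ≤ (μ + a) * (μ + c)) (x₀ y₀ x₁ y₁ x₂ y₂ x₃ y₃ : ℝ) :
    0 ≤ μ * (x₀ ^ 2 + y₀ ^ 2 + (x₁ ^ 2 + y₁ ^ 2) + (x₂ ^ 2 + y₂ ^ 2) + (x₃ ^ 2 + y₃ ^ 2)) +
      2 * a * (x₀ * x₁ + y₀ * y₁ + (x₁ * x₂ + y₁ * y₂) + (x₂ * x₃ + y₂ * y₃)) +
      2 * b * (x₀ * x₂ + y₀ * y₂ + (x₁ * x₃ + y₁ * y₃)) + 2 * c * (x₀ * x₃ + y₀ * y₃) := by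
  set F := μ * (x₀ ^ 2 + y₀ ^ 2 + (x₁ ^ 2 + y₁ ^ 2) + (x₂ ^ 2 + y₂ ^ 2) + (x₃ ^ 2 + y₃ ^ 2)) +
      2 * a * (x₀ * x₁ + y₀ * y₁ + (x₁ * x₂ + y₁ * y₂) + (x₂ * x₃ + y₂ * y₃)) +
      2 * b * (x₀ * x₂ + y₀ * y₂ + (x₁ * x₃ + y₁ * y₃)) + 2 * c * (x₀ * x₃ + y₀ * y₃) with hF
  set D := (μ + a) * (μ + c) - (a + b) ^ 2 with hD
  have hD0 : 0 ≤ D := by rw [hD]; linarith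
  have key : 2 * (μ - c) * (μ + c) * F =
      (μ + c) * (((μ - c) * (x₀ - x₃) + (a - b) * (x₁ - x₂)) ^ 2 + ((μ - c) * (y₀ - y₃) + (a - b) * (y₁ - y₂)) ^ 2) +
      (μ - c) * (((μ + c) * (x₀ + x₃) + (a + b) * (x₁ + x₂)) ^ 2 + ((μ + c) * (y₀ + y₃) + (a + b) * (y₁ + y₂)) ^ 2 +
        D * ((x₁ + x₂) ^ 2 + (y₁ + y₂) ^ 2)) := by
    rw [hF, hD]; linear_combination ((μ + c) * ((x₁ - x₂) ^ 2 + (y₁ - y₂) ^ 2)) * hroot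
  have h1 : 0 < μ - c := by linarith
  have h2 : 0 < μ + c := by linarith
  have hS : 0 ≤ 2 * (μ - c) * (μ + c) * F := by
    rw [key]
    have : 0 ≤ D * ((x₁ + x₂) ^ 2 + (y₁ + y₂) ^ 2) := by positivity
    have : 0 ≤ (μ - c) * (((μ + c) * (x₀ + x₃) + (a + b) * (x₁ + x₂)) ^ 2 +
        ((μ + c) * (y₀ + y₃) + (a + b) * (y₁ + y₂)) ^ 2 + D * ((x₁ + x₂) ^ 2 + (y₁ + y₂) ^ 2)) :=
      mul_nonneg h1.le (by positivity)
    positivity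
  by_contra h
  push Not at h
  have : 2 * (μ - c) * (μ + c) * F < 0 := mul_neg_of_pos_of_neg (by positivity) h
  linarith

/-- The fibre certificate for THREE atoms: with `a = log p/√p`, `b = log p/p`, `c₃ = log p/(p√p)` and
`μ₃ = ((a + c₃) + √((a − c₃)² + 4(a − b)²))/2`, the `m = 3` fibre form of `re_weilSemilocalQuadratic_erase_ge_of_cert` is nonnegative
(`sos_three` with `(μ₃ − a)(μ₃ − c₃) = (a − b)²` and `ac₃ = b²`). -/
theorem cert_three {p : ℕ} (hp : p.Prime) (G : ℤ → ℂ) (hG1 : ∀ n : ℤ, n < 0 → G n = 0) (hG2 : ∀ n : ℤ, ((3 : ℕ) : ℤ) < n → G n = 0) :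
    0 ≤ ((Real.log p / Real.sqrt p + Real.log p / (p * Real.sqrt p)) +
          Real.sqrt ((Real.log p / Real.sqrt p - Real.log p / (p * Real.sqrt p)) ^ 2 +
            4 * (Real.log p / Real.sqrt p - Real.log p / p) ^ 2)) / 2 * ∑ i ∈ Finset.range (3 + 1), ‖G i‖ ^ 2 +
      ∑ e ∈ Finset.range 3, Real.log p / Real.sqrt ((p : ℝ) ^ (e + 1)) *
        ∑ i ∈ Finset.range (3 + 1), (G i * conj (G ((i : ℤ) - (e + 1))) + G i * conj (G ((i : ℤ) + (e + 1)))).re := by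
  have hp0 : (0 : ℝ) < p := by exact_mod_cast hp.pos
  have hp1 : (1 : ℝ) < p := by exact_mod_cast hp.one_lt
  have hL : 0 < Real.log p := Real.log_pos hp1
  have hr0 : 0 < Real.sqrt p := Real.sqrt_pos.2 hp0
  have hr : Real.sqrt p ^ 2 = p := Real.sq_sqrt hp0.le
  have hsq2 : Real.sqrt ((p : ℝ) ^ 2) = p := Real.sqrt_sq hp0.le
  have hsq3 : Real.sqrt ((p : ℝ) ^ 3) = p * Real.sqrt p := by
    rw [show ((p : ℝ) ^ 3) = (p * Real.sqrt p) ^ 2 by nlinarith [hr], Real.sqrt_sq (by positivity)]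
  have h1 : G (-1) = 0 := hG1 (-1) (by norm_num)
  have h2 : G (-2) = 0 := hG1 (-2) (by norm_num)
  have h3 : G (-3) = 0 := hG1 (-3) (by norm_num)
  have h4 : G 4 = 0 := hG2 4 (by norm_num)
  have h5 : G 5 = 0 := hG2 5 (by norm_num)
  have h6 : G 6 = 0 := hG2 6 (by norm_num)
  norm_num only [Finset.sum_range_succ, Finset.sum_range_zero]
  simp only [h1, h2, h3, h4, h5, h6, hsq2, hsq3, pow_one, map_zero, mul_zero, zero_add, add_zero]
  have norm_sq_eq_re_im : ∀ z : ℂ, ‖z‖ ^ 2 = z.re ^ 2 + z.im ^ 2 := fun z ↦ by rw [Complex.sq_norm, Complex.normSq_apply]; ring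
  have re_mul_conj_eq : ∀ z w : ℂ, (z * conj w).re = z.re * w.re + z.im * w.im := fun z w ↦ by simp [Complex.mul_re]
  simp only [norm_sq_eq_re_im, Complex.add_re, Complex.zero_re, add_zero, re_mul_conj_eq]
  -- the weights and the closed form
  set a := Real.log p / Real.sqrt p with ha
  set b := Real.log p / p with hb
  set c₃ := Real.log p / (p * Real.sqrt p) with hc₃
  set R := Real.sqrt ((a - c₃) ^ 2 + 4 * (a - b) ^ 2) with hR
  have hR2 : R ^ 2 = (a - c₃) ^ 2 + 4 * (a - b) ^ 2 := Real.sq_sqrt (by positivity)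
  have hac : a * c₃ = b ^ 2 := by rw [ha, hb, hc₃]; field_simp; nlinarith [hr]
  have hca : c₃ < a := by
    rw [ha, hc₃]
    exact div_lt_div_of_pos_left hL hr0 (by nlinarith [hr0, hp1])
  have hc0 : 0 ≤ c₃ := by rw [hc₃]; positivity
  have ha0 : 0 ≤ a := by rw [ha]; positivity
  have hRge : a - c₃ ≤ R := Real.le_sqrt_of_sq_le (by nlinarith)
  have hμa : a ≤ ((a + c₃) + R) / 2 := by linarith
  have hμc : c₃ < ((a + c₃) + R) / 2 := by linarith
  have hroot : (((a + c₃) + R) / 2 - a) * (((a + c₃) + R) / 2 - c₃) = (a - b) ^ 2 := by nlinarith [hR2]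
  have hpd : (a + b) ^ 2 ≤ (((a + c₃) + R) / 2 + a) * (((a + c₃) + R) / 2 + c₃) := by
    have hmono : (a + a) * (a + c₃) ≤ (((a + c₃) + R) / 2 + a) * (((a + c₃) + R) / 2 + c₃) :=
      mul_le_mul (by linarith) (by linarith) (by linarith) (by linarith)
    nlinarith [sq_nonneg (a - b), hac, hmono]
  linarith [sos_three hc0 hμc hroot hpd (G 0).re (G 0).im (G 1).re (G 1).im (G 2).re (G 2).im (G 3).re (G 3).im]

/-- **THREE ATOMS, CLOSED FORM.**  For `p ∈ S` prime and `tsupport g ⊆ [−c, c]` with `2c < 4·log p` (at most `p, p², p³` visible), with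
`a = log p/√p`, `b = log p/p`, `c₃ = log p/(p√p)`:  `Re Q_{S∖{p}}(g) ≥ Re Q_S(g) − μ₃(p)‖g‖₂²`,

  `μ₃(p) = ((a + c₃) + √((a − c₃)² + 4(a − b)²))/2`  — `−μ₃(p)` = the bottom eigenvalue of `A₃(p)` (antisymmetric sector),

e.g. `μ₃(2) = log 2·(3 + √(25 − 16√2))/(4√2) = 0.556336` (lineage E: `U(1.35)∖{2}` free-odd `−0.556173`), `μ₃(3) = 0.764278`. -/
theorem re_weilSemilocalQuadratic_erase_ge_three (hg : IsWeilTest g) {S : Finset ℕ} {p : ℕ} (hp : p.Prime) (hpS : p ∈ S)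
    {c : ℝ} (hsupp : tsupport g ⊆ Icc (-c) c) (hc : 2 * c < 4 * Real.log p) :
    (weilSemilocalQuadratic S g).re -
        ((Real.log p / Real.sqrt p + Real.log p / (p * Real.sqrt p)) +
          Real.sqrt ((Real.log p / Real.sqrt p - Real.log p / (p * Real.sqrt p)) ^ 2 +
            4 * (Real.log p / Real.sqrt p - Real.log p / p) ^ 2)) / 2 * ∫ u : ℝ, ‖g u‖ ^ 2 ≤
      (weilSemilocalQuadratic (S.erase p) g).re := by
  have hm : 2 * c < ((3 : ℕ) + 1) * Real.log p := by push_cast; linarith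
  exact re_weilSemilocalQuadratic_erase_ge_of_cert hg hp hpS hsupp hm fun G hG1 hG2 ↦ cert_three hp G hG1 hG2

/-- **Three-atom floor for the bottoms:** `λ_min(S∖{p}; c; P) ≥ λ_min(S; c; P) − μ₃(p)` whenever `2c < 4·log p`. -/
theorem semilocalGroundEnergy_erase_ge_three {S : Finset ℕ} {p : ℕ} (hp : p.Prime) (hpS : p ∈ S) {c : ℝ}
    (hc : 2 * c < 4 * Real.log p) :
    semilocalGroundEnergy S P c -
        ((Real.log p / Real.sqrt p + Real.log p / (p * Real.sqrt p)) +
          Real.sqrt ((Real.log p / Real.sqrt p - Real.log p / (p * Real.sqrt p)) ^ 2 +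
            4 * (Real.log p / Real.sqrt p - Real.log p / p) ^ 2)) / 2 ≤
      semilocalGroundEnergy (S.erase p) P c := by
  have hp0 : (0 : ℝ) < p := by exact_mod_cast hp.pos
  have hμ0 : 0 ≤ ((Real.log p / Real.sqrt p + Real.log p / (p * Real.sqrt p)) +
      Real.sqrt ((Real.log p / Real.sqrt p - Real.log p / (p * Real.sqrt p)) ^ 2 +
        4 * (Real.log p / Real.sqrt p - Real.log p / p) ^ 2)) / 2 := by
    have := Real.log_nonneg (by exact_mod_cast hp.one_lt.le : (1 : ℝ) ≤ p)
    positivity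
  rcases (semilocalSphereValues (S.erase p) P c).eq_empty_or_nonempty with he | hne
  · have he' : semilocalSphereValues S P c = ∅ := by
      rcases (semilocalSphereValues S P c).eq_empty_or_nonempty with h0 | h0
      · exact h0
      · have := (semilocalSphereValues_nonempty_iff S P c).1 h0
        rw [← semilocalSphereValues_nonempty_iff (S.erase p) P c, he] at this
        exact absurd this Set.not_nonempty_empty
    rw [semilocalGroundEnergy, semilocalGroundEnergy, he, he', Real.sInf_empty]
    linarith
  · refine le_semilocalGroundEnergy hne fun g hg hs hPg hn ↦ ?_
    have h1 := re_weilSemilocalQuadratic_erase_ge_three hg hp hpS hs hc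
    have h2 := semilocalGroundEnergy_le_re (S := S) hg hs hPg hn
    rw [hn, mul_one] at h1
    linarith

end Summit.RiemannHypothesis.RiemannHypothesis.Theorems.SemilocalDeletionToeplitzFloorTwo

end
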